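import Summits.AtomisticToContinuum.HydrodynamicLimit.Theorems.AntiMazurCoboundariesCorrectorPressureDecayKiferTangentEntropyDebt

/-!
# The wall of line `FirstLemma` without the `toReal` junk value — crux stmt-AtomisticToContinuum-14135
`AntiMazurCoboundaries.CorrectorPressureDecay` ("X"); lead seat a1

Second self-audit reshape. The cycle-2 wall `EntropicBoltzmannTangent` (…KiferTangent.lean) concludes
`|bias(μ)| ≤ (specificRelEntropy μ G).toReal`: if the specific relative entropy were `⊤` for some admissible dilute reference `G`
the right-hand side is the junk value `0` and the wall would demand ZERO bias — a vacuity smell (CONVENTIONS §4), not the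
intended statement. The registered wall is therefore re-typed as `EntropicBoltzmannPropertyTangent` with the conclusion in
`ℝ≥0∞`: `ENNReal.ofReal |bias(μ)| ≤ specificRelEntropy μ G` (trivial when the entropy is infinite, as it should be); it is
IMPLIED by the old wall (`entropicBoltzmannPropertyTangent_of_entropicBoltzmannTangent`), and the bridge assembly goes through
unchanged because along a tangent state the entropy stub bounds `specificRelEntropy μ G` by a finite `ofReal`:
`stub_tangentAssemblyLaw : TangentTightness → TangentBias → TangentEntropyLowDensity → EntropicBoltzmannPropertyTangent → ASDD`
and `correctorPressureDecay_of_tangentLaw`. The `def` is a posited statement of the line, not a literature fact.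
-/

noncomputable section

open MeasureTheory ProbabilityTheory Set Filter Topology
open scoped ENNReal

namespace Summit.AtomisticToContinuum.HydrodynamicLimit.Theorems.KiferCompactification

open Literature.MathematicalPhysics.KineticTheory (T3 V3 hsDiameter localGibbsLaw blowUpPoint)
open Literature.MathematicalPhysics.KineticTheory.PointProcess (laplaceFunctional specificRelEntropy)
open Literature.Analysis.FluidPDE (HardSphereFlow Config IsHardSphereGibbs IsTranslationInvariant windowSumReal)
open Literature.Analysis.FunctionSpaces (PointConfig)

/-- **ENTROPIC BOLTZMANN PROPERTY FOR TANGENT STATES, `ℝ≥0∞` form** (the registered WALL `stub_entropicBoltzmannTangent` of line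
`FirstLemma`; C⁺): for every `θ, u₀` there are `z₀, κ > 0` such that every translation-invariant tangent state pays at least as
much specific relative entropy (w.r.t. any translation-invariant Gibbs state of activity `z < z₀`, inverse temperature `θ⁻¹`,
drift `u₀`) per unit volume as its fast one-body bias per unit volume:
`ofReal |E_μ[Σ_{p ∈ ω ∩ [0,1)³×ℝ³} g((p.2 − u₀)/√θ)]| ≤ h(μ | G)` in `[0, ∞]`, for admissible `g` (`|g| ≤ κ`, `g ⊥ 1, v, |v|²`).
Open; not implied by the crux (LSC gap); posited, never asserted. -/
def EntropicBoltzmannPropertyTangent : Prop :=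
  ∀ (θ : ℝ) (u₀ : V3), 0 < θ → ∃ z₀ : ℝ, 0 < z₀ ∧ ∃ κ : ℝ, 0 < κ ∧
  ∀ (σ a : ℝ), 0 < σ → 0 < a →
  ∀ (φ : T3 → ℝ), Continuous φ → (∀ x, 0 ≤ φ x) → (∀ x, φ x ≤ 1) → 0 < ∫ x, φ x →
  ∀ (N : ℕ → ℕ)
    (Φ : ∀ k, HardSphereFlow (Literature.Analysis.FluidPDE.Torus.geometry (Fin 3)) (hsDiameter σ (N k)) (N k + 1))
    (Q : ∀ k, Measure (Config (N k + 1) (Fin 3) T3)),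
    IsTangentFamily σ a θ u₀ κ N Φ Q →
    ∀ (ι : ℕ → ℕ) (μ : Measure (PointConfig (V3 × V3))), IsTangentState σ φ N Q ι μ →
      IsProbabilityMeasure μ → IsTranslationInvariant μ →
    ∀ (z : ℝ) (G : Measure (PointConfig (V3 × V3))), 0 < z → z < z₀ →
      IsHardSphereGibbs 1 z θ⁻¹ u₀ G → IsTranslationInvariant G →
    ∀ (g : V3 → ℝ), Continuous g → (∀ v, |g v| ≤ κ) →
      (∀ (c₀ c₂ : ℝ) (b : V3), ∫ v, g v * (c₀ + inner ℝ b v + c₂ * ‖v‖ ^ 2) ∂(stdGaussian V3) = 0) →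
      ENNReal.ofReal |∫ ω, windowSumReal ω (Literature.Analysis.FunctionSpaces.Torus.unitCube (Fin 3))
          (fun p => g ((Real.sqrt θ)⁻¹ • (p.2 - u₀))) ∂μ| ≤ specificRelEntropy μ G

/-- A measurable real function with `|f| ≤ C` is integrable against a finite measure. -/
private theorem integrable_of_abs_le₃ {α : Type*} [MeasurableSpace α] {μ : Measure α} [IsFiniteMeasure μ]
    {f : α → ℝ} (hfm : Measurable f) {C : ℝ} (hfC : ∀ x, |f x| ≤ C) : Integrable f μ :=
  Integrable.of_bound hfm.aestronglyMeasurable C (ae_of_all _ fun x => by rw [Real.norm_eq_abs]; exact hfC x)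

/-- On a probability space, `∫ f ≤ C` when `|f| ≤ C`. -/
private theorem integral_le_of_abs_le₃ {α : Type*} [MeasurableSpace α] {μ : Measure α} [IsProbabilityMeasure μ]
    {f : α → ℝ} {C : ℝ} (hfC : ∀ x, |f x| ≤ C) : ∫ x, f x ∂μ ≤ C := by
  have h1 : ‖∫ x, f x ∂μ‖ ≤ C * (μ Set.univ).toReal :=
    norm_integral_le_of_norm_le_const (Filter.Eventually.of_forall fun x => by
      rw [Real.norm_eq_abs]; exact hfC x)
  rw [measure_univ, ENNReal.toReal_one, mul_one, Real.norm_eq_abs] at h1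
  exact (le_abs_self _).trans h1

/-- A continuous nonnegative function on `𝕋³` that does not vanish identically has positive integral. -/
private theorem integral_pos_of_continuous_of_nonneg₃ {φ : T3 → ℝ} (hφ : Continuous φ) (h0 : ∀ x, 0 ≤ φ x)
    {x₀ : T3} (hx : φ x₀ ≠ 0) : 0 < ∫ x, φ x := by
  have hint : Integrable φ (volume : Measure T3) :=
    hφ.integrable_of_hasCompactSupport (HasCompactSupport.of_compactSpace φ)
  rw [integral_pos_iff_support_of_nonneg h0 hint]
  exact (hφ.isOpen_support).measure_pos volume ⟨x₀, Function.mem_support.2 hx⟩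

/-- Pointwise splitting `a·b = ½·(a⁺·(2b)) + ½·(a⁻·(−2b))`. -/
private theorem mul_eq_posPart_negPart₃ (a b : ℝ) :
    a * b = 2⁻¹ * (max a 0 * (2 * b)) + 2⁻¹ * (max (-a) 0 * (-2 * b)) := by
  have h := max_zero_sub_max_neg_zero_eq_self a
  calc a * b = (max a 0 - max (-a) 0) * b := by rw [h]
    _ = 2⁻¹ * (max a 0 * (2 * b)) + 2⁻¹ * (max (-a) 0 * (-2 * b)) := by ring


/-- The old (`toReal`) wall implies the `ℝ≥0∞` wall: if `h(μ|G) = ⊤` the new conclusion is trivial, otherwise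
`|bias| ≤ h.toReal` lifts through `ofReal`. -/
theorem entropicBoltzmannPropertyTangent_of_entropicBoltzmannTangent (h : EntropicBoltzmannTangent) :
    EntropicBoltzmannPropertyTangent := by
  intro θ u₀ hθ
  obtain ⟨z₀, hz₀, κ, hκ, hmain⟩ := h θ u₀ hθ
  refine ⟨z₀, hz₀, κ, hκ, ?_⟩
  intro σ a hσ ha φ hφ hφ0 hφ1 hφi N Φ Q hfam ι μ hμ hμP hμT z G hz hzz₀ hG hGT g hg hgκ horth
  have hw := hmain σ a hσ ha φ hφ hφ0 hφ1 hφi N Φ Q hfam ι μ hμ hμP hμT z G hz hzz₀ hG hGT g hg hgκ horth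
  by_cases htop : specificRelEntropy μ G = ⊤
  · rw [htop]; exact le_top
  · rw [← ENNReal.ofReal_toReal htop]
    exact ENNReal.ofReal_le_ofReal hw

/-- **BRIDGE ASSEMBLY for the `ℝ≥0∞` wall** (registered stub `stub_tangentAssemblyLaw`): as `stub_tangentAssemblyDilute`, the
finiteness of `h(μ|G)` along a tangent state coming from the entropy stub. -/
theorem stub_tangentAssemblyLaw :
    TangentTightness → TangentBias → TangentEntropyLowDensity → EntropicBoltzmannPropertyTangent →
      AlmostStationaryDualDecay := by
  intro hT hB hE hW a θ u₀ ha hθ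
  obtain ⟨z₀, hz₀, κ, hκ, hWmain⟩ := hW θ u₀ hθ
  obtain ⟨σ₁, hσ₁, hE⟩ := hE
  refine ⟨min (min (1 / 2) (z₀ / 2)) σ₁, by positivity, fun σ hσ hσlt => ?_⟩
  have hσm : σ < min (1 / 2) (z₀ / 2) := hσlt.trans_le (min_le_left _ _)
  have hσσ₁ : σ < σ₁ := hσlt.trans_le (min_le_right _ _)
  have hσhalf : σ ≤ 1 / 2 := hσm.le.trans (min_le_left _ _)
  have hσz : 2 * σ ^ 3 < z₀ := by
    have h1 : σ < z₀ / 2 := hσm.trans_le (min_le_right _ _)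
    have h2 : σ ≤ 1 := hσhalf.trans (by norm_num)
    have h3 : σ ^ 3 ≤ σ := by
      calc σ ^ 3 = σ * (σ * σ) := by ring
        _ ≤ σ * (1 * 1) := by gcongr
        _ = σ := by ring
    linarith
  have hprob : ∀ (N : ℕ)
      (Φ : HardSphereFlow (Literature.Analysis.FluidPDE.Torus.geometry (Fin 3)) (hsDiameter σ N) (N + 1)),
      IsProbabilityMeasure (localGibbsLaw σ (fun _ => a) (fun _ => u₀) (fun _ => θ) N Φ) := fun N Φ =>
    Literature.MathematicalPhysics.KineticTheory.isProbabilityMeasure_localGibbsLaw continuous_const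
      continuous_const continuous_const (fun _ => ha) (fun _ => hθ) hσhalf N Φ
  refine ⟨hprob, κ / 2, by positivity, ?_⟩
  /- MAIN CLAIM: nonnegative weights at amplitude `κ`. -/
  have main : ∀ (φ : T3 → ℝ), Continuous φ → (∀ x, 0 ≤ φ x) → (∀ x, φ x ≤ 1) →
      ∀ (g : V3 → ℝ), Continuous g → (∀ v, |g v| ≤ κ) →
      (∀ (c₀ c₂ : ℝ) (b : V3), ∫ v, g v * (c₀ + inner ℝ b v + c₂ * ‖v‖ ^ 2) ∂(stdGaussian V3) = 0) →
      ∀ δ : ℝ, 0 < δ → ∃ η : ℝ, 0 < η ∧ ∃ N₀ : ℕ, ∀ N : ℕ, N₀ ≤ N →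
        ∀ Φ : HardSphereFlow (Literature.Analysis.FluidPDE.Torus.geometry (Fin 3)) (hsDiameter σ N) (N + 1),
        ∀ Q : Measure (Config (N + 1) (Fin 3) T3), IsProbabilityMeasure Q →
          InformationTheory.klDiv Q (localGibbsLaw σ (fun _ => a) (fun _ => u₀) (fun _ => θ) N Φ) ≠ ⊤ →
          (∀ (f : Config (N + 1) (Fin 3) T3 → ℝ) (C : ℝ), Measurable f → (∀ z, |f z| ≤ C) →
            ∀ u : ℝ, 0 ≤ u →
              |(∫ z, f (Φ.flow u z) ∂Q) - ∫ z, f z ∂Q| ≤ η * (u * ((N + 1 : ℕ) : ℝ) ^ (1 / 3 : ℝ)) * C) →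
          (∫ z, (∑ i, φ (z i).1 * g ((Real.sqrt θ)⁻¹ • ((z i).2 - u₀))) ∂Q) -
              (InformationTheory.klDiv Q
                (localGibbsLaw σ (fun _ => a) (fun _ => u₀) (fun _ => θ) N Φ)).toReal ≤ δ * (N + 1) := by
    intro φ hφ hφ0 hφ1 g hg hgκ horth δ hδ
    have hφabs : ∀ x, |φ x| ≤ 1 := fun x => abs_le.2 ⟨by linarith [hφ0 x], hφ1 x⟩
    by_cases hzero : ∀ x, φ x = 0
    · refine ⟨1, one_pos, 0, fun N _ Φ Q hQ hfin hstat => ?_⟩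
      simp only [hzero, zero_mul, Finset.sum_const_zero, integral_zero, zero_sub]
      have h1 : 0 ≤ (InformationTheory.klDiv Q
          (localGibbsLaw σ (fun _ => a) (fun _ => u₀) (fun _ => θ) N Φ)).toReal := ENNReal.toReal_nonneg
      have h2 : (0 : ℝ) ≤ δ * (N + 1) := by positivity
      linarith
    push Not at hzero
    obtain ⟨x₀, hx₀⟩ := hzero
    have hφint : 0 < ∫ x, φ x := integral_pos_of_continuous_of_nonneg₃ hφ hφ0 hx₀
    by_contra hcon
    push Not at hcon
    have hfam : ∀ k : ℕ, ∃ N : ℕ, k ≤ N ∧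
        ∃ (Φ : HardSphereFlow (Literature.Analysis.FluidPDE.Torus.geometry (Fin 3)) (hsDiameter σ N) (N + 1))
          (Q : Measure (Config (N + 1) (Fin 3) T3)), IsProbabilityMeasure Q ∧
          InformationTheory.klDiv Q (localGibbsLaw σ (fun _ => a) (fun _ => u₀) (fun _ => θ) N Φ) ≠ ⊤ ∧
          (∀ (f : Config (N + 1) (Fin 3) T3 → ℝ) (C : ℝ), Measurable f → (∀ z, |f z| ≤ C) →
            ∀ u : ℝ, 0 ≤ u →
              |(∫ z, f (Φ.flow u z) ∂Q) - ∫ z, f z ∂Q| ≤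
                1 / ((k : ℝ) + 1) * (u * ((N + 1 : ℕ) : ℝ) ^ (1 / 3 : ℝ)) * C) ∧
          δ * (N + 1) < (∫ z, (∑ i, φ (z i).1 * g ((Real.sqrt θ)⁻¹ • ((z i).2 - u₀))) ∂Q) -
              (InformationTheory.klDiv Q
                (localGibbsLaw σ (fun _ => a) (fun _ => u₀) (fun _ => θ) N Φ)).toReal :=
      fun k => hcon (1 / ((k : ℝ) + 1)) (by positivity) k
    choose N hNk Φ Q hQprob hQfin hQstat hQbad using hfam
    -- per-`k` bookkeeping
    have hFb : ∀ k, ∀ z : Config (N k + 1) (Fin 3) T3,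
        |∑ i, φ (z i).1 * g ((Real.sqrt θ)⁻¹ • ((z i).2 - u₀))| ≤ κ * (N k + 1) := fun k =>
      (stub_windowFunctional (Φ k) θ u₀ φ g κ hφ hg hφabs hgκ 1 one_pos).2.1
    set b : ℕ → ℝ := fun k =>
      (∫ z, (∑ i, φ (z i).1 * g ((Real.sqrt θ)⁻¹ • ((z i).2 - u₀))) ∂(Q k)) / ((N k : ℝ) + 1) with hbdef
    set h : ℕ → ℝ := fun k =>
      (InformationTheory.klDiv (Q k)
        (localGibbsLaw σ (fun _ => a) (fun _ => u₀) (fun _ => θ) (N k) (Φ k))).toReal / ((N k : ℝ) + 1)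
      with hhdef
    have hkey : ∀ k, δ < b k - h k ∧ 0 ≤ h k ∧ b k ≤ κ ∧
        (InformationTheory.klDiv (Q k)
          (localGibbsLaw σ (fun _ => a) (fun _ => u₀) (fun _ => θ) (N k) (Φ k))).toReal ≤ κ * (N k + 1) := by
      intro k
      haveI := hQprob k
      have hn1 : (0 : ℝ) < (N k : ℝ) + 1 := by positivity
      have hI : (∫ z, (∑ i, φ (z i).1 * g ((Real.sqrt θ)⁻¹ • ((z i).2 - u₀))) ∂(Q k)) ≤ κ * (N k + 1) :=
        integral_le_of_abs_le₃ (hFb k)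
      have hK0 : 0 ≤ (InformationTheory.klDiv (Q k)
          (localGibbsLaw σ (fun _ => a) (fun _ => u₀) (fun _ => θ) (N k) (Φ k))).toReal := ENNReal.toReal_nonneg
      have hbad := hQbad k
      refine ⟨?_, div_nonneg hK0 hn1.le, ?_, ?_⟩
      · rw [hbdef, hhdef]
        simp only
        rw [← sub_div, lt_div_iff₀ hn1]
        linarith
      · rw [hbdef]
        simp only
        rw [div_le_iff₀ hn1]
        linarith
      · have : (0 : ℝ) ≤ δ * (N k + 1) := by positivity
        linarith
    -- the tangent family
    have hfamily : IsTangentFamily σ a θ u₀ κ N Φ Q := by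
      refine ⟨hNk, hQprob, fun k => ?_, fun k => 1 / ((k : ℝ) + 1), tendsto_one_div_add_atTop_nhds_zero_nat,
        fun k => hQstat k⟩
      rw [← ENNReal.ofReal_toReal (hQfin k)]
      exact ENNReal.ofReal_le_ofReal (hkey k).2.2.2
    -- tangent state, bias, entropy, wall
    obtain ⟨ι, μ, hμprob, hμTI, hμtan⟩ := hT σ a θ u₀ κ hσ ha hθ hκ φ hφ hφ0 hφ1 hφint N Φ Q hfamily
    have hbias := hB σ a θ u₀ κ hσ ha hθ hκ φ hφ hφ0 hφ1 hφint g hg hgκ N Φ Q hfamily ι μ hμtan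
    obtain ⟨z, Gi, hz, hz2, hGibbs, hGTI, hent⟩ :=
      hE σ a θ u₀ κ hσ hσσ₁ ha hθ hκ φ hφ hφ0 hφ1 hφint N Φ Q hfamily ι μ hμtan hμprob hμTI
    have hzz₀ : z < z₀ := hz2.trans_lt hσz
    have hwall := hWmain σ a hσ ha φ hφ hφ0 hφ1 hφint N Φ Q hfamily ι μ hμtan hμprob hμTI z Gi hz hzz₀
      hGibbs hGTI g hg hgκ horth
    -- notation for the limit objects
    set c : ℝ := (∫ x, φ x)⁻¹ * σ ^ 3 with hcdef
    have hcpos : 0 < c := by positivity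
    set βμ : ℝ := ∫ ω, windowSumReal ω (Literature.Analysis.FunctionSpaces.Torus.unitCube (Fin 3))
      (fun p => g ((Real.sqrt θ)⁻¹ • (p.2 - u₀))) ∂μ with hβdef
    -- (i) the bias along `ι` converges to `βμ / c`
    have hbias' : Tendsto (fun k => c * b (ι k)) atTop (𝓝 βμ) := by
      refine hbias.congr' (Filter.Eventually.of_forall fun k => ?_)
      rw [hbdef, hcdef]
      simp only
      rw [Nat.cast_succ, div_eq_inv_mul]
      ring
    have hbtend : Tendsto (fun k => b (ι k)) atTop (𝓝 (βμ / c)) := by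
      have := hbias'.const_mul c⁻¹
      simp only [← mul_assoc, inv_mul_cancel₀ hcpos.ne', one_mul] at this
      rwa [div_eq_inv_mul]
    have hβ_ge : c * δ ≤ βμ := by
      refine ge_of_tendsto hbias' (Filter.Eventually.of_forall fun k => ?_)
      have := (hkey (ι k)).1
      have := (hkey (ι k)).2.1
      nlinarith
    -- (ii) `liminf h ≤ βμ / c − δ`
    have hlim : liminf (fun k => h (ι k)) atTop ≤ βμ / c - δ := by
      calc liminf (fun k => h (ι k)) atTop ≤ liminf (fun k => b (ι k) - δ) atTop := by
            refine Filter.liminf_le_liminf (Filter.Eventually.of_forall fun k => ?_) ?_ ?_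
            · linarith [(hkey (ι k)).1]
            · exact Filter.isBoundedUnder_of ⟨0, fun k => (hkey (ι k)).2.1⟩
            · exact Filter.IsBoundedUnder.isCoboundedUnder_ge
                (Filter.isBoundedUnder_of ⟨κ - δ, fun k => by linarith [(hkey (ι k)).2.2.1]⟩)
        _ = βμ / c - δ := (hbtend.sub_const δ).liminf_eq
    -- (iii) entropy LSC: `h(μ|G) ≤ βμ − cδ`
    have hent' : specificRelEntropy μ Gi ≤ ENNReal.ofReal (c * liminf (fun k => h (ι k)) atTop) := by
      refine hent.trans (le_of_eq ?_)
      congr 1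
      rw [hcdef, hhdef]
      congr 1
      refine Filter.liminf_congr (Filter.Eventually.of_forall fun k => ?_)
      simp only
      rw [Nat.cast_succ, div_eq_inv_mul]
    have hs : (specificRelEntropy μ Gi).toReal ≤ βμ - c * δ := by
      have h1 : (specificRelEntropy μ Gi).toReal ≤
          (ENNReal.ofReal (c * liminf (fun k => h (ι k)) atTop)).toReal :=
        ENNReal.toReal_mono ENNReal.ofReal_ne_top hent'
      rw [ENNReal.toReal_ofReal'] at h1
      have h2 : c * liminf (fun k => h (ι k)) atTop ≤ βμ - c * δ := by
        have := mul_le_mul_of_nonneg_left hlim hcpos.le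
        have hcc : c * (βμ / c - δ) = βμ - c * δ := by field_simp
        linarith
      have h3 : (0 : ℝ) ≤ βμ - c * δ := by linarith
      exact h1.trans (max_le h2 h3)
    -- (iv) the wall closes the contradiction (`h(μ|G)` is finite by the entropy bound, so `ofReal |βμ| ≤ h` un-junks)
    have hfin : specificRelEntropy μ Gi ≠ ⊤ := ne_top_of_le_ne_top ENNReal.ofReal_ne_top hent'
    have hwall' : |βμ| ≤ (specificRelEntropy μ Gi).toReal := by
      have := ENNReal.toReal_mono hfin hwall
      rwa [ENNReal.toReal_ofReal (abs_nonneg _)] at this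
    have hfinal : βμ ≤ βμ - c * δ := (le_abs_self βμ).trans (hwall'.trans hs)
    linarith [mul_pos hcpos hδ]
  /- GENERAL WEIGHTS: split `φ = φ⁺ − φ⁻` against `±2g`. -/
  intro φ g hφ hg hφ1 hgκ horth δ hδ
  have hφp : Continuous fun x => max (φ x) 0 := hφ.max continuous_const
  have hφm : Continuous fun x => max (-φ x) 0 := hφ.neg.max continuous_const
  have hφp0 : ∀ x, 0 ≤ max (φ x) 0 := fun x => le_max_right _ _
  have hφm0 : ∀ x, 0 ≤ max (-φ x) 0 := fun x => le_max_right _ _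
  have hφp1 : ∀ x, max (φ x) 0 ≤ 1 := fun x => max_le ((le_abs_self _).trans (hφ1 x)) zero_le_one
  have hφm1 : ∀ x, max (-φ x) 0 ≤ 1 := fun x => max_le ((neg_le_abs _).trans (hφ1 x)) zero_le_one
  have hg2 : Continuous fun v => 2 * g v := continuous_const.mul hg
  have hg2' : Continuous fun v => -2 * g v := continuous_const.mul hg
  have hg2κ : ∀ v, |2 * g v| ≤ κ := fun v => by
    rw [abs_mul, abs_two]; linarith [hgκ v]
  have hg2κ' : ∀ v, |-2 * g v| ≤ κ := fun v => by
    rw [abs_mul, abs_neg, abs_two]; linarith [hgκ v]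
  have horth2 : ∀ (c₀ c₂ : ℝ) (b : V3),
      ∫ v, (2 * g v) * (c₀ + inner ℝ b v + c₂ * ‖v‖ ^ 2) ∂(stdGaussian V3) = 0 := fun c₀ c₂ b => by
    simp_rw [mul_assoc]
    rw [integral_const_mul, horth c₀ c₂ b, mul_zero]
  have horth2' : ∀ (c₀ c₂ : ℝ) (b : V3),
      ∫ v, (-2 * g v) * (c₀ + inner ℝ b v + c₂ * ‖v‖ ^ 2) ∂(stdGaussian V3) = 0 := fun c₀ c₂ b => by
    simp_rw [mul_assoc]
    rw [integral_const_mul, horth c₀ c₂ b, mul_zero]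
  obtain ⟨η₁, hη₁, N₁, h₁⟩ := main _ hφp hφp0 hφp1 _ hg2 hg2κ horth2 δ hδ
  obtain ⟨η₂, hη₂, N₂, h₂⟩ := main _ hφm hφm0 hφm1 _ hg2' hg2κ' horth2' δ hδ
  refine ⟨min η₁ η₂, lt_min hη₁ hη₂, max N₁ N₂, fun N hN Φ Q hQ hfin hstat => ?_⟩
  have hmono : ∀ η', min η₁ η₂ ≤ η' →
      ∀ (f : Config (N + 1) (Fin 3) T3 → ℝ) (C : ℝ), Measurable f → (∀ z, |f z| ≤ C) → ∀ u : ℝ, 0 ≤ u →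
        |(∫ z, f (Φ.flow u z) ∂Q) - ∫ z, f z ∂Q| ≤ η' * (u * ((N + 1 : ℕ) : ℝ) ^ (1 / 3 : ℝ)) * C := by
    intro η' hη' f C hf hfC u hu
    have hC : 0 ≤ C := (abs_nonneg _).trans (hfC fun _ => ((0 : T3), (0 : V3)))
    refine (hstat f C hf hfC u hu).trans ?_
    have : 0 ≤ u * ((N + 1 : ℕ) : ℝ) ^ (1 / 3 : ℝ) := by positivity
    gcongr
  have hA := h₁ N ((le_max_left _ _).trans hN) Φ Q hQ hfin (hmono η₁ (min_le_left _ _))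
  have hB' := h₂ N ((le_max_right _ _).trans hN) Φ Q hQ hfin (hmono η₂ (min_le_right _ _))
  -- the splitting of the one-body sum
  haveI := hQ
  have hφabs : ∀ x, |φ x| ≤ 1 := hφ1
  have hφpabs : ∀ x, |max (φ x) 0| ≤ 1 := fun x => by rw [abs_of_nonneg (hφp0 x)]; exact hφp1 x
  have hφmabs : ∀ x, |max (-φ x) 0| ≤ 1 := fun x => by rw [abs_of_nonneg (hφm0 x)]; exact hφm1 x
  have hgκ' : ∀ v, |g v| ≤ κ := fun v => (hgκ v).trans (by linarith)
  obtain ⟨hFm, hFb, -⟩ := stub_windowFunctional Φ θ u₀ φ g κ hφ hg hφabs hgκ' 1 one_pos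
  obtain ⟨hFpm, hFpb, -⟩ := stub_windowFunctional Φ θ u₀ (fun x => max (φ x) 0) (fun v => 2 * g v) κ hφp hg2
    hφpabs hg2κ 1 one_pos
  obtain ⟨hFmm, hFmb, -⟩ := stub_windowFunctional Φ θ u₀ (fun x => max (-φ x) 0) (fun v => -2 * g v) κ hφm hg2'
    hφmabs hg2κ' 1 one_pos
  have hsplit : (∫ z, (∑ i, φ (z i).1 * g ((Real.sqrt θ)⁻¹ • ((z i).2 - u₀))) ∂Q) =
      2⁻¹ * (∫ z, (∑ i, max (φ (z i).1) 0 * (2 * g ((Real.sqrt θ)⁻¹ • ((z i).2 - u₀)))) ∂Q) +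
        2⁻¹ * (∫ z, (∑ i, max (-φ (z i).1) 0 * (-2 * g ((Real.sqrt θ)⁻¹ • ((z i).2 - u₀)))) ∂Q) := by
    rw [← integral_const_mul, ← integral_const_mul,
      ← integral_add ((integrable_of_abs_le₃ hFpm hFpb).const_mul _) ((integrable_of_abs_le₃ hFmm hFmb).const_mul _)]
    refine integral_congr_ae (ae_of_all _ fun z => ?_)
    simp only [Finset.mul_sum, ← Finset.sum_add_distrib]
    exact Finset.sum_congr rfl fun i _ => mul_eq_posPart_negPart₃ _ _
  rw [hsplit]
  linarith

/-- **The line's composition, final form**: tightness, bias continuity, low-density entropy bound and the `ℝ≥0∞` wall give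
the crux. -/
theorem correctorPressureDecay_of_tangentLaw (hT : TangentTightness) (hB : TangentBias) (hE : TangentEntropyLowDensity)
    (hW : EntropicBoltzmannPropertyTangent) :
    Summit.AtomisticToContinuum.HydrodynamicLimit.Theses.AntiMazurCoboundaries.CorrectorPressureDecay :=
  Summit.AtomisticToContinuum.HydrodynamicLimit.Theorems.CorrectorPressureDecayEquivalences.correctorPressureDecay_of_kineticFluxLdDecay
    (stub_reduction (stub_tangentAssemblyLaw hT hB hE hW))

end Summit.AtomisticToContinuum.HydrodynamicLimit.Theorems.KiferCompactification
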